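import Summits.BirchSwinnertonDyer.BirchSwinnertonDyer.Theorems.ThetaPartnerAtTwoSignedControlAtTwoPlusLocalInjOfHonda
import HarnessLib

/-!
# The v5 stub `stub_plusCyclicLayersTwo` (CYC⁺@2) of K4 `SignedControlAtTwo` (stmt-BirchSwinnertonDyer-20309, line `eulerchar`
# v5 ed67af6018b68521) VERBATIM ⟸ a plus Honda system at `2` (HONDA⁺@2) — the one-line glue over `SignedEC.plusCyclic_of_honda`
# with the local layer degrees discharged

Seat `prover-bsd-wall-tp2-p3-w3` (width seat 3/3). For the lead's next reshape: the registered stub CYC⁺@2 may be replaced by the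
stub HONDA⁺@2 (the data Honda theory at `2` produces: Kobayashi §8.4 Lemma 8.9 / Prop. 8.11 on the `ℤ₂`-tower, Sprung 2012
Thm. 2.2 (2′) traced points WITH generation); this file is the closing line of CYC⁺@2 over HONDA⁺@2 (`SignedEC.plusCyclic_of_honda`,
p583526, with (NT) from `SSFlatEC.eq_zero_of_mem_localTowerPointsOfEmb_of_two_nsmul` and (IDX) from
`SignedEC.index_subgroupOf_localLayerSubgroupOfEmb_succ_eq`, p584033).

HONEST FRAMING: THEOREMS ONLY (no definition, no named fact, no `sorry`), route-independent; closes nothing by itself (both sides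
are stubs' bodies); BSD is not proved by any of this.

References: [Kobayashi2003] §8.4 (Lemma 8.9, Prop. 8.11, Prop. 8.12); [Sprung2012] Thm. 2.2, Lemma 2.3; [Washington1997] §13.1.
-/

set_option autoImplicit false
-- the Theorems namespace of this sub repeats the summit name by design (D-0017 nested layout)
set_option linter.dupNamespace false

noncomputable section

open scoped Classical NumberField

open NumberField IsDedekindDomain WeierstrassCurve Literature.NumberTheory.EllipticCurves
  Literature.NumberTheory.EllipticCurves.Kobayashi2003 Literature.NumberTheory.EllipticCurves.Sprung2012

namespace Summit.BirchSwinnertonDyer.BirchSwinnertonDyer.Theorems.SignedEC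

/-- **CYC⁺@2 for one curve, one cyclotomic `κ`, the place `v ∋ 2`, from a plus Honda system at `v`** (good supersingular `2`):
`plusCyclic_of_honda` with (NT) and (IDX) discharged. [cite: Kobayashi2003, §8.4 (Lemma 8.9, Prop. 8.11, Prop. 8.12)]
[cite: Sprung2012, Thm. 2.2, Lemma 2.3] -/
theorem plusCyclicLayers_two_of_honda (W : WeierstrassCurve ℚ) [W.IsElliptic] [W.IsGloballyMinimal]
    (hss : Rank1Residual.GoodSS W 2) {κ : ZpExtension ℚ 2} (hκ : κ.IsCyclotomic)
    (v : HeightOneSpectrum (𝓞 ℚ)) (hv : (2 : 𝓞 ℚ) ∈ v.asIdeal)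
    (d : ℕ → localPoints W (v.adicCompletion ℚ))
    (hd : ∀ m, d m ∈ localLayerPointsOfEmb κ (closureEmb (K := ℚ) (v.adicCompletion ℚ)) W m)
    (htr : ∀ m, localTraceOfEmb κ (closureEmb (K := ℚ) (v.adicCompletion ℚ)) W (m + 1) (m + 2) (d (m + 2)) = -d m)
    (hgen : ∀ m : ℕ, 1 ≤ m → ∀ P ∈ localLayerPointsOfEmb κ (closureEmb (K := ℚ) (v.adicCompletion ℚ)) W m,
      ∃ B ∈ AddSubgroup.closure (Set.range fun σ : Field.absoluteGaloisGroup (v.adicCompletion ℚ) ↦ σ • d m),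
        ∃ P' ∈ localLayerPointsOfEmb κ (closureEmb (K := ℚ) (v.adicCompletion ℚ)) W (m - 1),
        ∃ R ∈ localLayerPointsOfEmb κ (closureEmb (K := ℚ) (v.adicCompletion ℚ)) W m, P = B + P' + 2 • R)
    (hgen0 : ∀ P ∈ localLayerPointsOfEmb κ (closureEmb (K := ℚ) (v.adicCompletion ℚ)) W 0,
      ∃ a : ℤ, ∃ R ∈ localLayerPointsOfEmb κ (closureEmb (K := ℚ) (v.adicCompletion ℚ)) W 0, P = a • d 0 + 2 • R) :
    ∀ n : ℕ, ∃ dd ∈ signedLocalPoints κ (v.adicCompletion ℚ) W 1 n,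
      ∀ x ∈ signedLocalPoints κ (v.adicCompletion ℚ) W 1 n,
      ∃ B ∈ AddSubgroup.closure (Set.range fun σ : Field.absoluteGaloisGroup (v.adicCompletion ℚ) ↦ σ • dd),
        ∃ b ∈ signedLocalPoints κ (v.adicCompletion ℚ) W 1 n, x = B + 2 • b := by
  have hnt : ∀ P ∈ localTowerPointsOfEmb κ (closureEmb (K := ℚ) (v.adicCompletion ℚ)) W, 2 • P = 0 → P = 0 :=
    fun P hP h2 ↦ SSFlatEC.eq_zero_of_mem_localTowerPointsOfEmb_of_two_nsmul W hss κ (by exact_mod_cast hv) _ hP h2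
  have hidx := index_subgroupOf_localLayerSubgroupOfEmb_succ_eq (p := 2) hκ v (by exact_mod_cast hv)
  exact plusCyclic_of_honda W κ (closureEmb (K := ℚ) (v.adicCompletion ℚ)) hnt hidx d hd htr hgen hgen0

/-- **The registered v5 stub `stub_plusCyclicLayersTwo` (CYC⁺@2) VERBATIM ⟸ (HONDA⁺@2) over the sub-row** — for the lead's
reshape CYC ↦ HONDA. [cite: Kobayashi2003, §8.4 (Prop. 8.11, Prop. 8.12)] [cite: Sprung2012, Thm. 2.2 (2′)]
[cite: KuriharaOtsuki2006, p. 557] -/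
theorem stub_plusCyclicLayersTwo_of_honda
    (hHONDA : ∀ (W : WeierstrassCurve ℚ) [W.IsElliptic] [W.IsGloballyMinimal],
      ¬ W.HasCM → W.analyticRank = 0 → Rank1Residual.GoodSS W 2 → W.frobeniusTrace 2 = 0 →
      ∀ (κ : ZpExtension ℚ 2), κ.IsCyclotomic →
      ∀ (v : HeightOneSpectrum (𝓞 ℚ)), (2 : 𝓞 ℚ) ∈ v.asIdeal →
      ∃ d : ℕ → localPoints W (v.adicCompletion ℚ),
        (∀ m, d m ∈ localLayerPointsOfEmb κ (closureEmb (K := ℚ) (v.adicCompletion ℚ)) W m) ∧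
        (∀ m, localTraceOfEmb κ (closureEmb (K := ℚ) (v.adicCompletion ℚ)) W (m + 1) (m + 2) (d (m + 2)) = -d m) ∧
        (∀ m : ℕ, 1 ≤ m → ∀ P ∈ localLayerPointsOfEmb κ (closureEmb (K := ℚ) (v.adicCompletion ℚ)) W m,
          ∃ B ∈ AddSubgroup.closure (Set.range fun σ : Field.absoluteGaloisGroup (v.adicCompletion ℚ) ↦ σ • d m),
            ∃ P' ∈ localLayerPointsOfEmb κ (closureEmb (K := ℚ) (v.adicCompletion ℚ)) W (m - 1),
            ∃ R ∈ localLayerPointsOfEmb κ (closureEmb (K := ℚ) (v.adicCompletion ℚ)) W m, P = B + P' + 2 • R) ∧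
        (∀ P ∈ localLayerPointsOfEmb κ (closureEmb (K := ℚ) (v.adicCompletion ℚ)) W 0,
          ∃ a : ℤ, ∃ R ∈ localLayerPointsOfEmb κ (closureEmb (K := ℚ) (v.adicCompletion ℚ)) W 0, P = a • d 0 + 2 • R)) :
    ∀ (W : WeierstrassCurve ℚ) [W.IsElliptic] [W.IsGloballyMinimal],
      ¬ W.HasCM → W.analyticRank = 0 → Rank1Residual.GoodSS W 2 → W.frobeniusTrace 2 = 0 →
      ∀ (κ : ZpExtension ℚ 2), κ.IsCyclotomic →
      ∀ (v : HeightOneSpectrum (𝓞 ℚ)), (2 : 𝓞 ℚ) ∈ v.asIdeal →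
      ∀ n : ℕ, ∃ d ∈ signedLocalPoints κ (v.adicCompletion ℚ) W 1 n,
        ∀ x ∈ signedLocalPoints κ (v.adicCompletion ℚ) W 1 n,
        ∃ B ∈ AddSubgroup.closure (Set.range fun σ : Field.absoluteGaloisGroup (v.adicCompletion ℚ) ↦ σ • d),
          ∃ b ∈ signedLocalPoints κ (v.adicCompletion ℚ) W 1 n, x = B + 2 • b := by
  intro W _ _ hcm hr hss ha κ hκ v hv
  obtain ⟨d, hd, htr, hgen, hgen0⟩ := hHONDA W hcm hr hss ha κ hκ v hv
  exact plusCyclicLayers_two_of_honda W hss hκ v hv d hd htr hgen hgen0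

end Summit.BirchSwinnertonDyer.BirchSwinnertonDyer.Theorems.SignedEC

end
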